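import Summits.QuantumFields.BalabanUV.Beta.EriceRemainderEnclosureHistoryAutonomyComparisonAgeCompositionThreeAgesAbs
import Summits.QuantumFields.BalabanUV.Beta.EriceRemainderEnclosureHistoryAutonomyComparisonAgeCompositionThreeAgesDefectAbsReduction

/-!
# EriceRemainderEnclosureHistoryAutonomyComparisonAgeCompositionThreeAgesDefectAbs — (E87p) route (N), first order, THREE loaded ages: the socket v3° of (E87n) with its
# per-pair family (S-h°)_{(k₂,k₃)} REPLACED by the damping-free, chain-free product inequality (★h°) of (E87o) — the pair `(k₂,k₃)` asks an inequality
# between the levels and the loads alone, with no clipping hole where the chain-ratio majorant exceeds `1`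

Cell `pub-balaban`, β-function sub-cell, BINDER row D4 «RemainderConst leaves for Bałaban's split» (`HOME/BINDER-OWNERS.md`; owner lineage `b2b-balaban-beta-an4`;
this file by co-owner #2 lineage `b2b-balaban-beta-d4-p2`, generation 78), β-FLOW TEAM duty (1), FREEZE (0) honoured (def-free; imports (E87n), (E87o); uses
(E87n) `flow_nonneg_three_ages_abs_static`, (E87o) `static_defect_abs_of_product`, (E87i) `rho_mid_three_le`, (E80d) `aggregate_eq_sum`, (E80e)
`age_chain_closes`, (E82b) `row_mass_le` ∕ `load_le_of_window`, (E82c) `kernel_zero` BY NAME; nothing restated).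

HONEST FRAMING (page 1, verbatim and binding).  *"Discharging BetaPertH makes Bałaban's UV stability UNCONDITIONAL — a real constructive-QFT result; it is
NOT the continuum limit and NOT the Clay problem."*  THIS FILE DISCHARGES NOTHING OF THE KIND.  Elementary real analysis about ABSTRACT functionals on a box
]0,γ]^ℕ with displayed floors, profiles and signs, and the FIRST-ORDER renewal objects of route (N) built from them — hypotheses of a census, not facts; the
form, signs, ages and moments of Bałaban's (1.22) limit functional are NOT PRINTED ([I] p. 298; GAPS G-t4-U2-1∕-2) and NOT asserted.  Row D4 class
UNCHANGED (critical-path width 0; instance 0∕1; D4 DISCHARGE NO DATE).  HONEST DEPENDENCY: continuum YM on T⁴ ⇐ BetaPertH ∧ nine spine estimates (0/9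
proved); BetaPertH ⇐ (D1) ∧ (D4) ∧ CAP+tail; G-an2-4 gates asym, D1 and NE2/3/4.

THE POINT (census sense (α); route (N); README `HOME/b2b-balaban-beta-d4-p2/g78/e87/README.md` §3–§4).  **`flow_nonneg_three_ages_of_product_abs`**: the
damped END for `{1,k₂,k₃}` (every horizon `N ≥ K = k₃+1`, every damping of the relaxed class) modulo (S-b)₁, (S-a)∨(S-d) for `(1,k₂)` and `(1,k₃)`, the
tail sums ∨ (S-e″) for the middle age, (S-c♯) ∨ (S-f) above it — and, for the pair `(k₂,k₃)`, **(★h°)** at every pin `m` and truncation `j ≥ m+1+k₃`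
(displayed; `r_m = (h_{m+k₃+1}∕h_{m+k₃})³`, `q`, `c` the undamped coefficients of `k₂`, `k₃`, `Pf` the floor products, `τlo = max((1−ρUp)(1−k₃c), 1−k₃c−k₂q, 0)`,
`ALa` the floor-and-minorant young lower masses).  The aggregate identity `KA (k₂+1) = KL k₃` ((E80d)), `x̃₃ ≤ k₃c` ((E82b)), `ρ k₂ ≤ 1` ((E80e)), `ρ k₂ ≤ ρUp`
((E87i)) and `k₃c ≤ 3∕4` at the pins `≥ 1` ((E82b)) are supplied here.  Census g78: (★h°) bench log-ratio `−0.60∕−0.45∕−0.34` (`k₃ = 8∕16∕32`, pins `≤ 2`), never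
violated; large `k₃` and the adversarial census: README.  NOT CLAIMED: (★h°) along flows (successor: the (E84b)–(E85) machinery); anything nonlinear; anything
printed — NOT B12 Thm 2, NOT BetaPertH.

WHAT IS PROVED ([folklore]; 0 `def`, 0 sorry).  §1 **`flow_nonneg_three_ages_of_product_abs`**.
-/
noncomputable section
open Finset

namespace Summit.QuantumFields.BalabanUV.Beta.EriceRemainderEnclosureHistoryAutonomyComparisonAgeCompositionThreeAgesDefectAbs

open Literature.MathematicalPhysics.QuantumFieldTheory.Balaban1983to89
open Literature.MathematicalPhysics.QuantumFieldTheory.Balaban1983to89.T4BetaStationary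
open Literature.MathematicalPhysics.QuantumFieldTheory.Balaban1983to89.T4BetaFlowWellPosed
open Summit.QuantumFields.BalabanUV.Beta.EriceRemainderEnclosureHistoryAutonomyOrder (strictAnti_of_memFlow)
open Summit.QuantumFields.BalabanUV.Beta.EriceRemainderEnclosureHistoryAutonomyComparisonAgeCompositionYoungestTailSumFlow (row_mass_le load_le_of_window)
open Summit.QuantumFields.BalabanUV.Beta.EriceRemainderEnclosureHistoryAutonomyComparisonAgeCompositionYoungestTailSumWiring (kernel_zero)
open Summit.QuantumFields.BalabanUV.Beta.EriceRemainderEnclosureHistoryAutonomyComparisonAgeCompositionChainWiring (aggregate_eq_sum)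
open Summit.QuantumFields.BalabanUV.Beta.EriceRemainderEnclosureHistoryAutonomyComparisonAgeCompositionChainWiringAtPin (age_chain_closes)
open Summit.QuantumFields.BalabanUV.Beta.EriceRemainderEnclosureHistoryAutonomyComparisonAgeCompositionThreeAgesAbs (flow_nonneg_three_ages_abs_static)
open Summit.QuantumFields.BalabanUV.Beta.EriceRemainderEnclosureHistoryAutonomyComparisonAgeCompositionThreeAgesDefectReduction (rho_mid_three_le)
open Summit.QuantumFields.BalabanUV.Beta.EriceRemainderEnclosureHistoryAutonomyComparisonAgeCompositionThreeAgesDefectAbsReduction (static_defect_abs_of_product)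

variable {B : (ℕ → ℝ) → ℝ} {γ b gIR : ℝ} {L : ℕ → ℝ} {K : ℕ} {h g : ℕ → ℝ} {KL : ℕ → ℕ → ℕ → ℝ}

/-! ## §1 The three-age socket on (★h°) -/

/-- **ROUTE (N), FIRST ORDER — THE THREE-AGE SOCKET ON THE DAMPING-FREE PRODUCT INEQUALITY (★h°).**  As (E87n) `flow_nonneg_three_ages_abs_static` with
the hypothesis `hpair23` REPLACED by (★h°) at every pin and truncation (displayed; levels and loads only): the (S-h°) member of `hpair23` is then §1
`static_defect_abs_of_product`, fed with the aggregate identity `KA (k₂+1) = KL k₃` ((E80d) `aggregate_eq_sum`) and `x̃₃ ≤ k₃c` ((E82b) `row_mass_le`),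
`ρ k₂ ≤ 1` ((E80e) `age_chain_closes`), `ρ k₂ ≤ ρUp` at the pins `≥ 1` ((E87i) `rho_mid_three_le`), and `k₃c ≤ 3∕4` at the pins `≥ 1` ((E82b)
`load_le_of_window`).  CONCLUSION: `ε ≥ 0` at every pin for every admissible excess. [folklore] -/
theorem flow_nonneg_three_ages_of_product_abs (hmono : ∀ u v : ℕ → ℝ, SeqBox γ u → SeqBox γ v → (∀ j, u j ≤ v j) → B u ≤ B v)
    (hL : ∀ k, 0 ≤ L k) (hb : 0 < b) (hlo : ∀ u, SeqBox γ u → b ≤ B u) (hdom : ∀ u, SeqBox γ u → ∑ k ∈ range K, L k * u k ≤ B u)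
    (hh : SeqBox γ h) (hf : MemFlow B gIR h)
    (hg : ∀ t, 0 < g t ∧ g t ≤ 1) (hgF : ∀ t, 1 / (1 + ∑ k ∈ range K, L k * h (t + k) ^ 3 / 2) ≤ g t)
    {k₂ k₃ : ℕ} (hk2 : 2 ≤ k₂) (hk23 : k₂ < k₃) (hKk : K = k₃ + 1) (hL3 : ∀ j, j < K → j ≠ 1 → j ≠ k₂ → j ≠ k₃ → L j = 0) {N : ℕ} (hKN : K ≤ N)
    (hKL : ∀ k n l, KL k n l = if 0 < k ∧ k < K ∧ l < k then L k * h (n + k) ^ 3 / 2 * ∏ t ∈ Ico (n + 1 + l) (n + k + 1), g t else 0)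
    {θ : ℕ → ℕ → ℕ → ℝ} (hθ : ∀ k n l, θ k n l = 1 - (h (n + k + l) / h (n + k)) ^ 3 * ∏ t ∈ Ico (n + k + 1) (n + k + l + 1), g t)
    {KA : ℕ → ℕ → ℕ → ℝ} {RL RA SL SA : ℕ → (ℕ → ℝ) → ℕ → ℝ}
    (hRL : ∀ i v m, RL i v m = ∑ l ∈ range K, KL i m l * v (m + 1 + l))
    (hRA : ∀ i v m, RA i v m = ∑ l ∈ range K, KA i m l * v (m + 1 + l))
    (hKA : ∀ i m l, KA i m l = KL i m l + KA (i + 1) m l) (hKAtop : ∀ m l, KA K m l = 0)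
    (hSL : ∀ i (w : ℕ → ℝ), (∀ m, N < m → w m = 0) → (∀ m, N < m → SL i w m = 0) ∧ ∀ m, SL i w m = w m - RL i (SL i w) m)
    (hSA : ∀ i (w : ℕ → ℝ), (∀ m, N < m → w m = 0) → (∀ m, N < m → SA i w m = 0) ∧ ∀ m, SA i w m = w m - RA i (SA i w) m)
    {ρ : ℕ → ℕ → ℝ} {β : ℕ → ℕ → ℕ → ℝ}
    (hρ : ∀ i n, 1 ≤ i → i ≤ K - 1 → ρ i n = (∑ l ∈ range K, KL i n l) * (1 + ∑ k ∈ Ioc i (K - 1), θ k n i * β (i + 1) n k) /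
      (1 - ∑ k ∈ Ioc i (K - 1), ∑ l ∈ range i, KL k n l))
    (hβnew : ∀ i n, 1 ≤ i → i ≤ K - 1 → β i n i = ρ i n / (1 - ρ i n))
    (hβold : ∀ i n k, 1 ≤ i → i < k → k ≤ K - 1 → β i n k = β (i + 1) n k / (1 - ρ i n))
    {Hg : ℕ → ℕ → ℝ} (hH : ∀ i m, Hg i m = (1 + ∑ k ∈ Ioc i (K - 1), θ k m 1 * β (i + 1) m k) / (1 - ∑ k ∈ Ioc i (K - 1), KL k m 0))
    {AL : ℕ → ℕ → ℕ → ℝ} (hAL : ∀ i j p, AL i j p = ∑ l ∈ range i, if p + 1 + l ≤ j then KL i p l * (1 - ρ i (p + 1 + l)) else 0)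
    {Tτ : ℕ → ℕ → ℕ → ℝ} (hTτ : ∀ i m p', Tτ i m p' = max (max (max ((1 - ρ i p') * (1 - ∑ l ∈ range K, KA (i + 1) (m + 2) l))
      ((1 - ρ i p') * (1 - ∑ l ∈ range K, KA (i + 1) p' l))) ((1 - ∑ l ∈ range K, KA (i + 1) p' l) - ∑ l ∈ range K, KL i p' l)) 0)
    {TA : ℕ → ℕ → ℕ → ℕ → ℝ} (hTA : ∀ i j m p, TA i j m p = ∑ l ∈ range i, if p + 1 + l ≤ j then KL i p l * Tτ i m (p + 1 + l) else 0)
    {M : ℕ → ℕ → ℝ} (hM : ∀ i m, M i m = KL i m 0 + ∑ l ∈ range (K - 1), max (KL i m (l + 1) - KL i (m + 1) l) 0)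
    {HgS : ℕ → ℕ → ℕ → ℝ} (hHS : ∀ i j m, HgS i j m = (1 + ∑ k ∈ Ioc i (K - 1), θ k m 1 * β (i + 1) m k) /
      (1 - ∑ k ∈ Ioc i (K - 1), (KL k m 0 - if m + 1 + k ≤ j then KL k (m + 1) (k - 1) else 0)))
    (hSb1 : ∀ m, (1 + M 1 m) * (Hg 1 (m + 1) * KL 1 (m + 1) 0) ≤ KL 1 m 0)
    (hpair12 : (∀ n, ∑ l ∈ range k₂, KL k₂ (n + 1) l ≤ ∑ l ∈ range k₂, KL k₂ n l) ∨
      (∀ m, KL k₂ (m + 1) (k₂ - 1) * KL 1 (m + 1 + k₂) 0 * ∏ p ∈ Ico (m + 2) (m + 2 + k₂), Hg 1 p ≤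
        KL k₂ m 0 * KL 1 (m + 1) 0 * (1 - KL 1 (m + 2) 0 * Hg 1 (m + 2))))
    (hpair13 : (∀ n, ∑ l ∈ range k₃, KL k₃ (n + 1) l ≤ ∑ l ∈ range k₃, KL k₃ n l) ∨
      (∀ m, KL k₃ (m + 1) (k₃ - 1) * KL 1 (m + 1 + k₃) 0 * ∏ p ∈ Ico (m + 2) (m + 2 + k₃), Hg 1 p ≤
        KL k₃ m 0 * KL 1 (m + 1) 0 * (1 - KL 1 (m + 2) 0 * Hg 1 (m + 2))))
    (hlev2 : ((∀ m L', L' < k₂ → (1 + M k₂ m) * ∑ l ∈ Ico L' k₂, Hg k₂ (m + 1 + l) * KL k₂ (m + 1) l ≤ ∑ l ∈ Ico L' k₂, KL k₂ m l) ∧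
        (∀ m L₀, L₀ < k₂ → ∀ L', L' ≤ L₀ → (1 + M k₂ m) * ∑ l ∈ Ico L' L₀, Hg k₂ (m + 1 + l) * KL k₂ (m + 1) l ≤ ∑ l ∈ Ico L' (L₀ + 1), KL k₂ m l)) ∨
      (∀ m, KL k₂ (m + 1) (k₂ - 1) ≤ (1 - (1 - θ k₂ m 1)) * ∑ l ∈ range k₂, KL k₂ m l * (1 - ρ k₂ (m + 1 + l)) / ∏ p ∈ Ico (m + 1 + l) (m + 1 + k₂), Hg k₂ p +
        (1 - θ k₂ m 1) * (KL k₂ m 0 * (1 - ρ k₂ (m + 1)) / ∏ p ∈ Ico (m + 1) (m + 1 + k₂), Hg k₂ p)))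
    -- (★h°) IN PLACE OF `hpair23`: a damping-free, chain-free inequality between the levels and the loads
    {q c F ρUp τlo : ℕ → ℝ} {Pf ALa : ℕ → ℕ → ℝ} (hq : ∀ n, q n = L k₂ * h (n + k₂) ^ 3 / 2) (hc : ∀ n, c n = L k₃ * h (n + k₃) ^ 3 / 2)
    (hF : ∀ t, F t = ∑ j ∈ range K, L j * h (t + j) ^ 3 / 2) (hPf : ∀ a b, Pf a b = (∏ t ∈ Ico a (b + 1), (1 + F t))⁻¹)
    (hρUp : ∀ p, ρUp p = (k₂ * q p) * (1 + (1 - (h (p + k₃ + k₂) / h (p + k₃)) ^ 3 * (∏ t ∈ Ico (p + k₃ + 1) (p + k₃ + k₂ + 1), (1 + F t))⁻¹) *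
      ((k₃ * c p) / (1 - k₃ * c p))) / (1 - k₂ * c p))
    (hτlo : ∀ p', τlo p' = max (max ((1 - ρUp p') * (1 - k₃ * c p')) (1 - k₃ * c p' - k₂ * q p')) 0)
    (hALa : ∀ j p, ALa j p = q p * ∑ l ∈ range k₂, if p + 1 + l ≤ j then Pf (p + 1 + l) (p + k₂) * τlo (p + 1 + l) else 0)
    (hprod : ∀ m j, m + 1 + k₃ ≤ j →
      (h (m + k₃ + 1) / h (m + k₃)) ^ 3 * q (m + 1 + k₃) * (∑ l ∈ range k₂, if m + 2 + k₃ + l ≤ j then (1:ℝ) else 0) ≤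
        (1 - (h (m + k₃ + 1) / h (m + k₃)) ^ 3) * ∑ l' ∈ range k₃, Pf (m + 1 + l') (m + k₃) * ALa j (m + 1 + l') +
          (h (m + k₃ + 1) / h (m + k₃)) ^ 3 * (Pf (m + 1) (m + k₃) * ALa j (m + 1)))
    (hM1top' : ((∀ m j, m + 1 + N ≤ j → ∀ L', L' < N →
          ∑ l ∈ Ico L' N, HgS k₂ j (m + 1 + l) * KA (k₂ + 1) (m + 1) l ≤ ∑ l ∈ Ico L' N, KA (k₂ + 1) m l) ∧
        (∀ m L₀, L₀ < N → ∀ L', L' ≤ L₀ →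
          ∑ l ∈ Ico L' L₀, HgS k₂ (m + 1 + L₀) (m + 1 + l) * KA (k₂ + 1) (m + 1) l ≤ ∑ l ∈ Ico L' (L₀ + 1), KA (k₂ + 1) m l)) ∨
      (∀ m, KL k₃ (m + 1) (k₃ - 1) - (1 - θ k₃ m 1) * KL k₃ m 0 ≤
        (∑ l ∈ range k₃, KL k₃ (m + 1) l * (1 - ∑ l' ∈ range k₃, KL k₃ (m + 2 + l) l')) * (1 - (1 - θ k₃ m 1) - (1 - θ k₃ m 1) * KL k₃ m 0)))
    {e ε : ℕ → ℝ} (he0 : ∀ m, 0 ≤ e m) (hea : ∀ m, e (m + 1) ≤ e m) (het : ∀ m, N < m → e m = 0)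
    (hεt : ∀ m, N < m → ε m = 0) (hεrec : ∀ m, ε m = e m - RA 1 ε m) : ∀ m, 0 ≤ ε m := by
  have hpos : ∀ n, 0 < h n := fun n => (hh n).1
  have hanti := (strictAnti_of_memFlow hb hlo hh hf).antitone
  have hk3K : k₃ < K := by omega
  have hρ1 : ∀ p, ρ k₂ p ≤ 1 := fun p =>
    (age_chain_closes hmono hL hb hlo hdom hh hf hg hgF hKL hθ hρ hβnew hβold p (i := k₂) (by omega) (by omega)).1.le
  have hρle : ∀ p, 2 ≤ p → ρ k₂ p ≤ ρUp p := fun p hp =>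
    rho_mid_three_le hmono hL hb hlo hdom hh hf hg hgF hk2 hk23 hKk hL3 hKL hθ hρ hβnew hβold hq hc hF hρUp (by omega)
  have hx34 : ∀ n, 1 ≤ n → k₃ * c n ≤ 3 / 4 := fun n hn => by
    have h1 := load_le_of_window hmono hL hb hlo hdom hh hf hn hk3K
    have h2 : 0 ≤ (h (n + k₃) / h n) ^ 2 := sq_nonneg _
    rw [hc]; linarith
  -- the aggregate above the middle age is the oldest kernel: its row mass is at most `k₃ c`
  have hKA3 : ∀ m l, KA (k₂ + 1) m l = KL k₃ m l := fun m l => by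
    have e := aggregate_eq_sum (n := K - 1) hKA (fun m l => by rw [Nat.sub_add_cancel (by omega : 1 ≤ K)]; exact hKAtop m l)
      (show k₂ + 1 ≤ K - 1 + 1 by omega) m l
    rw [e, sum_eq_single_of_mem k₃ (mem_Ico.mpr ⟨by omega, by omega⟩) fun k hk hk3 => ?_]
    obtain ⟨hk1, hk2'⟩ := mem_Ico.mp hk
    exact kernel_zero hKL (hL3 k (by omega) (by omega) (by omega) hk3) m l
  have hXA : ∀ p, 1 ≤ p → ∑ l ∈ range K, KA (k₂ + 1) p l ≤ k₃ * c p := fun p _ => by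
    rw [sum_congr rfl fun l _ => hKA3 p l, hc]; exact row_mass_le hL hh hg hKL hk3K p
  exact flow_nonneg_three_ages_abs_static hmono hL hb hlo hdom hh hf hg hgF hk2 hk23 hKk hL3 hKN hKL hθ hRL hRA hKA hKAtop hSL hSA hρ hβnew hβold hH
    hAL hTτ hTA hM hHS hSb1 hpair12 hpair13 hlev2
    (Or.inr (Or.inr fun j m hm => static_defect_abs_of_product hL hh hanti hg hgF hk2 hk23 hk3K hKL hθ hρ1 hq hc hF hPf hx34
      (XA := fun p => ∑ l ∈ range K, KA (k₂ + 1) p l) hXA (fun m p' => hTτ k₂ m p') (fun j m p => hTA k₂ j m p) hρle hτlo hALa (hprod m) j hm))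
    hM1top' he0 hea het hεt hεrec

end Summit.QuantumFields.BalabanUV.Beta.EriceRemainderEnclosureHistoryAutonomyComparisonAgeCompositionThreeAgesDefectAbs

end
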